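import Literature.Combinatorics.Sahi2008.Indicators

/-!
# Sahi's `C₃` in dimension three, II-a: the order-3 SLOT FORM `T` on `[3]³` — trilinearity, axis-relabelling invariance, counting

Support file of the one-cut programme (crux `NoHeavyLowerTail`, stmt-CriticalPhenomena-4575; cell `prim-masterthm`, seat P3, gen 17;
`run/shared/lean/prim/prim-masterthm/prim-masterthm-p3/HIERARCHY.md` §25; memo `run/shared/lean/prim/prim-masterthm/FROM-prim-masterthm-p3-g17-THREE-CHAINS-C3.md`).
First of three files (`…SahiThreeChainSlotForm` → `…SahiThreeChainOrderThreeBridge` → `…SahiThreeChainOrderThree`) assembling, modulo one finite hypothesis,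
**Sahi's `C₃` in dimension three**: `E₃(f,g,h) ≥ 0` for every product probability weight on every product of three finite chains.

* `SahiThreeChain.T f g h` — the ORDER-3 SLOT FORM on `P = Fin 3 × Fin 3 × Fin 3`:
  `T = 16·Σ_z fgh(z) − Σ_{(z,z') non-attacking} [(fg)(z)h(z') + (fh)(z)g(z') + (gh)(z)f(z')] + Σ_{(z₁,z₂,z₃) pairwise non-attacking} f(z₁)g(z₂)h(z₃)`
  (`NonAtt`: two cells are NON-ATTACKING iff they differ in every coordinate; `nw` its `0/1` weight).  `T = (3!)³·Ẽ₃` is the gen-16 without-replacement functional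
  at order 3 in dimension 3 (set partitions `{123}`, `{12|3}`×3, `{1|2|3}`); on indicator triples of down-sets it is the integer `Φ` of the kernel certificate
  `…SahiThreeChainSlotCertificate`.
* `T_lin₀/₁/₂` (trilinearity), `axes`/`T_comp_axes` (invariance under relabelling the slots of each axis by permutations of `Fin 3`),
  `card_nonAtt` (every cell has `8` non-attacking partners), `card_nonAtt_pair` (a non-attacking pair has exactly one common third), `sum_sum_nw = 216`,
  `sum_sum_sum_nw = 216` (ordered non-attacking pairs / pairwise non-attacking triples).
Everything here is proved; axioms standard. [this work]
-/

noncomputable section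

namespace Summit.CriticalPhenomena.PercolationContinuityZ3.Theorems

open Finset Function
open Literature.Combinatorics.Sahi2008

namespace SahiThreeChain

/-- The slot grid `[3]³`. [this work] -/
abbrev P := Fin 3 × Fin 3 × Fin 3

/-- Two cells are NON-ATTACKING iff they differ in every coordinate. [this work] -/
def NonAtt (z z' : P) : Prop := z.1 ≠ z'.1 ∧ z.2.1 ≠ z'.2.1 ∧ z.2.2 ≠ z'.2.2

/-- `NonAtt` is decidable (needed for `nw`, the filters and `decide`). [this work] -/
instance : DecidableRel NonAtt := fun z z' => by unfold NonAtt; infer_instance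

/-- The `0/1` weight of a non-attacking ordered pair. [this work] -/
def nw (z z' : P) : ℝ := if NonAtt z z' then 1 else 0

/-- **The order-3 slot form** `T = (3!)³·Ẽ₃` on the slot grid `[3]³` (set partitions `{123}`, `{12|3}`×3, `{1|2|3}` of Sahi's `E₃` read without replacement:
`16Σ fgh − Σ_{non-attacking pairs}[(fg)⊗h + (fh)⊗g + (gh)⊗f] + Σ_{pairwise non-attacking triples} f⊗g⊗h`). [this work] -/
def T (f g h : P → ℝ) : ℝ :=
  16 * (∑ z, f z * g z * h z)
  - (∑ z, ∑ z', nw z z' * (f z * g z * h z' + f z * h z * g z' + g z * h z * f z'))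
  + ∑ z, ∑ z', ∑ z'', nw z z' * nw z z'' * nw z' z'' * (f z * g z' * h z'')

/-! ### Trilinearity -/

/-- `T` is linear in its first argument. [this work] -/
theorem T_lin₀ (a b : ℝ) (f₁ f₂ g h : P → ℝ) : T (a • f₁ + b • f₂) g h = a * T f₁ g h + b * T f₂ g h := by
  have e1 : ∀ z : P, (a • f₁ + b • f₂) z * g z * h z = a * (f₁ z * g z * h z) + b * (f₂ z * g z * h z) := fun z => by
    simp only [Pi.add_apply, Pi.smul_apply, smul_eq_mul]; ring
  have e2 : ∀ z z' : P, nw z z' * ((a • f₁ + b • f₂) z * g z * h z' + (a • f₁ + b • f₂) z * h z * g z' + g z * h z * (a • f₁ + b • f₂) z') =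
      a * (nw z z' * (f₁ z * g z * h z' + f₁ z * h z * g z' + g z * h z * f₁ z')) +
        b * (nw z z' * (f₂ z * g z * h z' + f₂ z * h z * g z' + g z * h z * f₂ z')) := fun z z' => by
    simp only [Pi.add_apply, Pi.smul_apply, smul_eq_mul]; ring
  have e3 : ∀ z z' z'' : P, nw z z' * nw z z'' * nw z' z'' * ((a • f₁ + b • f₂) z * g z' * h z'') =
      a * (nw z z' * nw z z'' * nw z' z'' * (f₁ z * g z' * h z'')) + b * (nw z z' * nw z z'' * nw z' z'' * (f₂ z * g z' * h z'')) :=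
    fun z z' z'' => by simp only [Pi.add_apply, Pi.smul_apply, smul_eq_mul]; ring
  simp only [T, e1, e2, e3, Finset.sum_add_distrib, ← Finset.mul_sum]
  ring

/-- `T` is linear in its second argument. [this work] -/
theorem T_lin₁ (a b : ℝ) (f g₁ g₂ h : P → ℝ) : T f (a • g₁ + b • g₂) h = a * T f g₁ h + b * T f g₂ h := by
  have e1 : ∀ z : P, f z * (a • g₁ + b • g₂) z * h z = a * (f z * g₁ z * h z) + b * (f z * g₂ z * h z) := fun z => by
    simp only [Pi.add_apply, Pi.smul_apply, smul_eq_mul]; ring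
  have e2 : ∀ z z' : P, nw z z' * (f z * (a • g₁ + b • g₂) z * h z' + f z * h z * (a • g₁ + b • g₂) z' + (a • g₁ + b • g₂) z * h z * f z') =
      a * (nw z z' * (f z * g₁ z * h z' + f z * h z * g₁ z' + g₁ z * h z * f z')) +
        b * (nw z z' * (f z * g₂ z * h z' + f z * h z * g₂ z' + g₂ z * h z * f z')) := fun z z' => by
    simp only [Pi.add_apply, Pi.smul_apply, smul_eq_mul]; ring
  have e3 : ∀ z z' z'' : P, nw z z' * nw z z'' * nw z' z'' * (f z * (a • g₁ + b • g₂) z' * h z'') =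
      a * (nw z z' * nw z z'' * nw z' z'' * (f z * g₁ z' * h z'')) + b * (nw z z' * nw z z'' * nw z' z'' * (f z * g₂ z' * h z'')) :=
    fun z z' z'' => by simp only [Pi.add_apply, Pi.smul_apply, smul_eq_mul]; ring
  simp only [T, e1, e2, e3, Finset.sum_add_distrib, ← Finset.mul_sum]
  ring

/-- `T` is linear in its third argument. [this work] -/
theorem T_lin₂ (a b : ℝ) (f g h₁ h₂ : P → ℝ) : T f g (a • h₁ + b • h₂) = a * T f g h₁ + b * T f g h₂ := by
  have e1 : ∀ z : P, f z * g z * (a • h₁ + b • h₂) z = a * (f z * g z * h₁ z) + b * (f z * g z * h₂ z) := fun z => by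
    simp only [Pi.add_apply, Pi.smul_apply, smul_eq_mul]; ring
  have e2 : ∀ z z' : P, nw z z' * (f z * g z * (a • h₁ + b • h₂) z' + f z * (a • h₁ + b • h₂) z * g z' + g z * (a • h₁ + b • h₂) z * f z') =
      a * (nw z z' * (f z * g z * h₁ z' + f z * h₁ z * g z' + g z * h₁ z * f z')) +
        b * (nw z z' * (f z * g z * h₂ z' + f z * h₂ z * g z' + g z * h₂ z * f z')) := fun z z' => by
    simp only [Pi.add_apply, Pi.smul_apply, smul_eq_mul]; ring
  have e3 : ∀ z z' z'' : P, nw z z' * nw z z'' * nw z' z'' * (f z * g z' * (a • h₁ + b • h₂) z'') =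
      a * (nw z z' * nw z z'' * nw z' z'' * (f z * g z' * h₁ z'')) + b * (nw z z' * nw z z'' * nw z' z'' * (f z * g z' * h₂ z'')) :=
    fun z z' z'' => by simp only [Pi.add_apply, Pi.smul_apply, smul_eq_mul]; ring
  simp only [T, e1, e2, e3, Finset.sum_add_distrib, ← Finset.mul_sum]
  ring

/-! ### Invariance under relabelling the slots of each axis -/

/-- The relabelling of the slot grid by three permutations of `Fin 3` (one per axis). [this work] -/
def axes (σ τ ρ : Equiv.Perm (Fin 3)) : P ≃ P :=
  Equiv.prodCongr σ (Equiv.prodCongr τ ρ)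

/-- The relabelling, pointwise. [this work] -/
theorem axes_apply (σ τ ρ : Equiv.Perm (Fin 3)) (z : P) : axes σ τ ρ z = (σ z.1, τ z.2.1, ρ z.2.2) := rfl

/-- Relabelling preserves the non-attacking relation. [this work] -/
theorem nonAtt_axes (σ τ ρ : Equiv.Perm (Fin 3)) (z z' : P) : NonAtt (axes σ τ ρ z) (axes σ τ ρ z') ↔ NonAtt z z' := by
  simp only [NonAtt, axes_apply, ne_eq, EmbeddingLike.apply_eq_iff_eq]

/-- Relabelling preserves the non-attacking weight. [this work] -/
theorem nw_axes (σ τ ρ : Equiv.Perm (Fin 3)) (z z' : P) : nw (axes σ τ ρ z) (axes σ τ ρ z') = nw z z' := by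
  unfold nw
  exact if_congr (nonAtt_axes σ τ ρ z z') rfl rfl

/-- **Axis-relabelling invariance**: `T(f∘m, g∘m, h∘m) = T(f,g,h)` for `m` = any product of three permutations of `Fin 3`. [this work] -/
theorem T_comp_axes (σ τ ρ : Equiv.Perm (Fin 3)) (f g h : P → ℝ) :
    T (f ∘ axes σ τ ρ) (g ∘ axes σ τ ρ) (h ∘ axes σ τ ρ) = T f g h := by
  set e := axes σ τ ρ with he
  have h1 : (∑ z, f z * g z * h z) = ∑ z, (f ∘ e) z * (g ∘ e) z * (h ∘ e) z :=
    (Equiv.sum_comp e (fun z => f z * g z * h z)).symm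
  have h2 : (∑ z, ∑ z', nw z z' * (f z * g z * h z' + f z * h z * g z' + g z * h z * f z')) =
      ∑ z, ∑ z', nw z z' * ((f ∘ e) z * (g ∘ e) z * (h ∘ e) z' + (f ∘ e) z * (h ∘ e) z * (g ∘ e) z' +
        (g ∘ e) z * (h ∘ e) z * (f ∘ e) z') := by
    rw [← Equiv.sum_comp e]
    refine Fintype.sum_congr _ _ fun z => ?_
    rw [← Equiv.sum_comp e]
    refine Fintype.sum_congr _ _ fun z' => ?_
    rw [he, nw_axes]
    rfl
  have h3 : (∑ z, ∑ z', ∑ z'', nw z z' * nw z z'' * nw z' z'' * (f z * g z' * h z'')) =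
      ∑ z, ∑ z', ∑ z'', nw z z' * nw z z'' * nw z' z'' * ((f ∘ e) z * (g ∘ e) z' * (h ∘ e) z'') := by
    rw [← Equiv.sum_comp e]
    refine Fintype.sum_congr _ _ fun z => ?_
    rw [← Equiv.sum_comp e]
    refine Fintype.sum_congr _ _ fun z' => ?_
    rw [← Equiv.sum_comp e]
    refine Fintype.sum_congr _ _ fun z'' => ?_
    rw [he, nw_axes, nw_axes, nw_axes]
    rfl
  unfold T
  rw [h1, h2, h3]

/-! #### Counting non-attacking pairs and triples -/

/-- Every cell has exactly `8` non-attacking partners. [this work] -/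
theorem card_nonAtt (z : P) : (univ.filter fun z' => NonAtt z z').card = 8 := by
  revert z
  decide

/-- A non-attacking pair has exactly ONE common non-attacking third cell. [this work] -/
theorem card_nonAtt_pair (z z' : P) (h : NonAtt z z') : (univ.filter fun z'' => NonAtt z z'' ∧ NonAtt z' z'').card = 1 := by
  revert z z'
  decide

/-- `Σ_{z'} nw z z' = 8`. [this work] -/
theorem sum_nw (z : P) : ∑ z', nw z z' = 8 := by
  unfold nw
  rw [Finset.sum_boole, card_nonAtt]
  norm_num

/-- `Σ_z Σ_{z'} nw z z' = 216` (the ordered non-attacking pairs). [this work] -/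
theorem sum_sum_nw : ∑ z : P, ∑ z', nw z z' = 216 := by
  simp_rw [sum_nw]
  rw [Finset.sum_const, Finset.card_univ]
  have : Fintype.card P = 27 := by simp [P, Fintype.card_prod, Fintype.card_fin]
  rw [this]
  norm_num

/-- For a non-attacking pair, `Σ_{z''} nw z z'' · nw z' z'' = 1`. [this work] -/
theorem sum_nw_mul_nw {z z' : P} (h : NonAtt z z') : ∑ z'', nw z z'' * nw z' z'' = 1 := by
  have hmul : ∀ z'', nw z z'' * nw z' z'' = if NonAtt z z'' ∧ NonAtt z' z'' then 1 else 0 := by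
    intro z''
    unfold nw
    split_ifs <;> simp_all
  simp_rw [hmul]
  rw [Finset.sum_boole, card_nonAtt_pair z z' h]
  norm_num

/-- `Σ_z Σ_{z'} Σ_{z''} nw z z' · nw z z'' · nw z' z'' = 216` (the ordered pairwise non-attacking triples). [this work] -/
theorem sum_sum_sum_nw : ∑ z : P, ∑ z', ∑ z'', nw z z' * nw z z'' * nw z' z'' = 216 := by
  have h : ∀ z z' : P, ∑ z'', nw z z' * nw z z'' * nw z' z'' = nw z z' := by
    intro z z'
    by_cases hzz' : NonAtt z z'
    · have h1 : nw z z' = 1 := by simp [nw, hzz']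
      simp_rw [mul_assoc, ← Finset.mul_sum, sum_nw_mul_nw hzz', h1, mul_one]
    · have h0 : nw z z' = 0 := by simp [nw, hzz']
      simp [h0]
  simp_rw [h]
  exact sum_sum_nw


end SahiThreeChain

end Summit.CriticalPhenomena.PercolationContinuityZ3.Theorems
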